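import Summits.BirchSwinnertonDyer.Rank1Residual.X2.HidaLimitRoadIntOther
import Summits.BirchSwinnertonDyer.BirchSwinnertonDyer.Theorems.EisensteinPrimesGoodLatticeMuLambdaDictionary
import HarnessLib

/-!
# Crux 4 `BSDpOnCellC` (stmt-BirchSwinnertonDyer-19034), line b1 v10, stub `stub_c3`: KELLER–YIN D′ AT
# `𝔭̄` IN THE MODULE-INVARIANT CURRENCY — the `𝓞_{ℂ_p}⟦T⟧` Weierstrass dictionary and
# `X2.Nonsplit/SplitMuLambdaOnTreeIntOther W p` ⟺ «`μ(X_ac^∅ strict at 𝔭̄) = 0` and the frame `Q` has its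
# first unit coefficient at `λ(X_ac^∅ strict at 𝔭̄)`» (cell `bsd-eis`, seat `bsd-line-x2-p2` gen 2,
# D-0154 KEY row 5; route `EisensteinPrimes`)

HONEST FRAMING (cell `bsd-eis`, run/shared/lean/pub/bsd-eis/): pure commutative algebra of
`Λ = ℤ_p⟦T⟧ → 𝓞_{ℂ_p}⟦T⟧` plus re-statements of the typed D′ half of the IMC atom of line b1; everything
is PROVED from tree theorems; nothing about any curve is asserted; nothing booked; X2 stays
CONSTRUCTION-SHAPED; no label or count moves; BSD and the anticyclotomic main conjecture are proved for
no curve. Helper attached to stmt-BirchSwinnertonDyer-19034 (`--supports`), closes no stub.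

## Why

The PUB-tier residual of `stub_c3` (skeleton b1 v10 f17b408e…) is, by `X2/HidaLimitRoadIntOther.lean`
(p489067) and `Theorems/…StubC3OtherLinks.lean`, [one divisibility half at `𝔭̄`: road R-β
`X2.Nonsplit/SplitKolyvaginDivOnTreeIntOther` or road H `X2.HidaLimitRevDivOnTreeIntOther`] + [D′ at `𝔭̄`:
`X2.Nonsplit/SplitMuLambdaOnTreeIntOther`]. The D′ predicates are typed in the FIRST-UNIT-COEFFICIENT
currency of the wide receptacle: for every generator `F` of `Ch_Λ(X_ac^∅ strict at 𝔭̄)` the series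
`F♭ = map toCpInt F ∈ 𝓞_{ℂ_p}⟦T⟧` and the frame `Q` have their first coefficient of norm `1` at the same
index. Print — Keller–Yin §5.1 (the Lemma «the `μ`-invariants of `𝔛^S_f` and `𝔛^S_{f_m}` are `0`» and
`algmain`), Castella–Grossi–Skinner, Greenberg–Vatsal — and the tree's own `λ`-apparatus for the partner
cruxes (`muInvariant`, `lambdaInvariant`, `GreenbergVatsal2000.lambda_nonPrimitive_eq_add_sum_delta`,
`X2/CongruentLambdaShift*`) speak instead of the INVARIANTS OF THE `Λ`-MODULE. Crux 2 received this
dictionary for its receptacle `R₀ = W(𝔽̄_p)` (`Theorems/EisensteinPrimesGoodLatticeMuLambdaDictionary.lean`);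
this file is the `𝓞_{ℂ_p}` twin and plugs it into D′ at `𝔭̄`:

* §1 `ℤ_p → 𝓞_{ℂ_p}` is an isometry on coefficients: the first-unit-coefficient shape of `F♭` at `n` is
  that of `F` in `ℤ_p` (`firstUnitCoeff_map_toCpInt_iff`) and of `map toUnr F` in `R₀` (`…_iff_map_toUnr`).
* §2 power-series currency: for `F ≠ 0` in `Λ`, the shape at `n` ⟺ `μ(F) = 0 ∧ λ(F) = n` (`X1.MuLambda`).
* §3 module currency: for a finitely generated torsion `Λ`-module `M` with `Ch_Λ M = (F)`, the shape of
  `F♭` at `n` ⟺ `μ(M) = 0 ∧ λ(M) = n` (`firstUnitCoeff_map_toCpInt_iff_invariants`).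
* §4 D′ at `𝔭̄`, both signs, FROM and TO the invariant currency on the real module `X_ac^∅(E_K[p^∞])`
  strict at `𝔭̄` (`…MuLambdaOnTreeIntOther_of_invariants`, `invariants_of_…MuLambdaOnTreeIntOther`): the D′
  input of `stub_c3` reads, in the kernel, as printed — «`X_ac^∅` is `Λ`-torsion, `μ(X_ac^∅) = 0`, and
  `μ(𝓛) = 0`, `λ(𝓛) = λ(X_ac^∅)`» for the frame `𝓛 = Q`.

What this is NOT: not a proof of D′, of torsion-ness, or of any divisibility; `stub_c3` is untouched.
References: [Washington1997] §7.1 Prop. 7.2 / Thm. 7.3, §13.2; [KellerYin2024] §5.1 (μ-Lemma, `algmain`;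
arXiv:2402.12781v2, PRE — locator only, nothing taken); [GreenbergVatsal2000] p. 2 (1)–(2); cell: RULING L31.
-/

set_option autoImplicit false
set_option linter.dupNamespace false -- the summit namespace `…BirchSwinnertonDyer.BirchSwinnertonDyer.Theorems` (Sub = Summit, D-0017) trips it

noncomputable section

open scoped Classical MatrixGroups ModularForm

open CongruenceSubgroup WeierstrassCurve NumberField IsDedekindDomain Field PowerSeries
  Literature.NumberTheory.EllipticCurves Literature.NumberTheory.EllipticCurves.GreenbergSelmer
  Literature.NumberTheory.EllipticCurves.GreenbergVatsal2000
  Literature.NumberTheory.EllipticCurves.ModularForms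
  Literature.NumberTheory.EllipticCurves.Rank1Residual
  Literature.NumberTheory.EllipticCurves.Rank1Residual.Typed
  Literature.NumberTheory.GaloisRepresentations Literature.NumberTheory.GaloisCohomology
  Literature.NumberTheory.Automorphic
  Summit.BirchSwinnertonDyer.Rank1Residual.X11b.AcSelmer
  Summit.BirchSwinnertonDyer.Rank1Residual.X11b.Halves
  Summit.BirchSwinnertonDyer.Rank1Residual.X11b
  Summit.BirchSwinnertonDyer.Rank1Residual Summit.BirchSwinnertonDyer.Rank1Residual.X1
  Summit.BirchSwinnertonDyer.Rank1Residual.X2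
  Summit.BirchSwinnertonDyer.BirchSwinnertonDyer.Theorems.EisensteinPrimesMuLambda

namespace Summit.BirchSwinnertonDyer.BirchSwinnertonDyer.Theorems.StubC3MuLambdaInvariants

variable {p : ℕ} [Fact p.Prime]

/-! ### §1 The structure map `ℤ_p → 𝓞_{ℂ_p}` on coefficients -/

/-- The structure map `toCpInt : ℤ_p → 𝓞_{ℂ_p} ⊂ ℂ_p` is an isometry on coefficients:
`‖[Tⁱ](map toCpInt F)‖_{ℂ_p} = ‖[Tⁱ]F‖_{ℤ_p}`. [folklore] -/
theorem norm_coeff_map_toCpInt (F : IwasawaAlgebra p) (i : ℕ) :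
    ‖((coeff i (PowerSeries.map (R1.toCpInt p) F) : 𝓞_ℂ_[p]) : ℂ_[p])‖ = ‖coeff i F‖ := by
  rw [coeff_map, R1.coe_toCpInt, norm_algebraMap', PadicInt.norm_def]

/-- **The first-unit-coefficient shape is read in `ℤ_p`.** For `F ∈ Λ` and `n`: «`‖[Tⁿ]F♭‖ = 1` and
`‖[Tⁱ]F♭‖ < 1` for `i < n`» in `𝓞_{ℂ_p}⟦T⟧` iff the same for `F` in `ℤ_p⟦T⟧`. [folklore] -/
theorem firstUnitCoeff_map_toCpInt_iff (F : IwasawaAlgebra p) (n : ℕ) :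
    (‖((coeff n (PowerSeries.map (R1.toCpInt p) F) : 𝓞_ℂ_[p]) : ℂ_[p])‖ = 1 ∧
        ∀ i < n, ‖((coeff i (PowerSeries.map (R1.toCpInt p) F) : 𝓞_ℂ_[p]) : ℂ_[p])‖ < 1) ↔
      (‖coeff n F‖ = 1 ∧ ∀ i < n, ‖coeff i F‖ < 1) := by
  simp only [norm_coeff_map_toCpInt]

/-- **The two wide receptacles agree**: the shape of `map toCpInt F` in `𝓞_{ℂ_p}⟦T⟧` at `n` iff the
shape of `map toUnr F` in `R₀⟦T⟧` at `n` (both are the `ℤ_p` shape; crux 2's receptacle vs crux 4's).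
[folklore] -/
theorem firstUnitCoeff_map_toCpInt_iff_map_toUnr (F : IwasawaAlgebra p) (n : ℕ) :
    (‖((coeff n (PowerSeries.map (R1.toCpInt p) F) : 𝓞_ℂ_[p]) : ℂ_[p])‖ = 1 ∧
        ∀ i < n, ‖((coeff i (PowerSeries.map (R1.toCpInt p) F) : 𝓞_ℂ_[p]) : ℂ_[p])‖ < 1) ↔
      (‖((coeff n (PowerSeries.map (toUnr p) F) : unrIntegers p) : ℂ_[p])‖ = 1 ∧
        ∀ i < n, ‖((coeff i (PowerSeries.map (toUnr p) F) : unrIntegers p) : ℂ_[p])‖ < 1) := by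
  simp only [norm_coeff_map_toCpInt, norm_coeff_map_toUnr]

/-! ### §2 Power-series currency: the shape at `n` ⟺ `μ(F) = 0 ∧ λ(F) = n` -/

/-- Unit content forces `μ(F) = 0` (`p ∤ F`). [cite: GreenbergVatsal2000, p. 2, (2)] -/
theorem mu_eq_zero_of_hasUnitContent {F : IwasawaAlgebra p} (hF : F ≠ 0) (h : HasUnitContent F) :
    MuLambda.mu F = 0 := by
  by_contra hne
  obtain ⟨k, hk⟩ := Nat.exists_eq_add_one_of_ne_zero hne
  have hdvd := MuLambda.C_pow_mu_dvd hF
  rw [hk, pow_succ, map_mul] at hdvd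
  exact (hasUnitContent_iff_not_C_dvd F).mp h (dvd_trans (Dvd.intro_left _ rfl) hdvd)

/-- With unit content, the `ℤ_p` shape holds exactly at `normLam F`. [cite: Washington1997, §7.1 (Prop. 7.2, Thm. 7.3)] -/
theorem firstUnitCoeff_iff_normLam_eq {F : IwasawaAlgebra p} (h : HasUnitContent F) (n : ℕ) :
    (‖coeff n F‖ = 1 ∧ ∀ i < n, ‖coeff i F‖ < 1) ↔ normLam F = n := by
  have h1 : ∃ m, ‖coeff m F‖ = 1 := (hasUnitContent_iff_exists_norm_eq_one F).mp h
  have hone : ‖coeff (normLam F) F‖ = 1 := X11a.LambdaNorm.norm_coeff_normLam_eq_one h1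
  constructor
  · rintro ⟨hn, hlt⟩
    by_contra hne
    rcases Nat.lt_or_gt_of_ne hne with hlt' | hgt
    · exact (hlt _ hlt').ne hone
    · have := X11a.LambdaNorm.norm_coeff_lt_of_lt_normLam (F := F) hgt
      rw [hone] at this
      exact this.ne hn
  · rintro rfl
    refine ⟨hone, fun i hi ↦ ?_⟩
    have := X11a.LambdaNorm.norm_coeff_lt_of_lt_normLam (F := F) hi
    rwa [hone] at this

/-- **Power-series dictionary.** For `F ≠ 0` in `Λ = ℤ_p⟦T⟧`: «first unit coefficient at `n`» iff
`μ(F) = 0` and `λ(F) = n` (`X1.MuLambda.mu/lam`: the exact power of `p` and the Weierstrass degree).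
[cite: Washington1997, §7.1 (Prop. 7.2, Thm. 7.3)] [cite: GreenbergVatsal2000, p. 2, (1)–(2)] -/
theorem firstUnitCoeff_iff_mu_eq_zero_and_lam_eq {F : IwasawaAlgebra p} (hF : F ≠ 0) (n : ℕ) :
    (‖coeff n F‖ = 1 ∧ ∀ i < n, ‖coeff i F‖ < 1) ↔ MuLambda.mu F = 0 ∧ MuLambda.lam F = n := by
  constructor
  · intro hn
    have huc : HasUnitContent F := (hasUnitContent_iff_exists_norm_eq_one F).mpr ⟨n, hn.1⟩
    refine ⟨mu_eq_zero_of_hasUnitContent hF huc, ?_⟩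
    rw [X11a.LambdaNorm.lam_eq_normLam huc]
    exact (firstUnitCoeff_iff_normLam_eq huc n).mp hn
  · rintro ⟨hμ, hlam⟩
    have huc : HasUnitContent F := hasUnitContent_of_mu_eq_zero' hF hμ
    rw [X11a.LambdaNorm.lam_eq_normLam huc] at hlam
    exact (firstUnitCoeff_iff_normLam_eq huc n).mpr hlam

/-- **Power-series dictionary, read in `𝓞_{ℂ_p}⟦T⟧`.** For `F ≠ 0` in `Λ`: the shape of
`F♭ = map toCpInt F` at `n` iff `μ(F) = 0 ∧ λ(F) = n`. [cite: Washington1997, §7.1 (Prop. 7.2, Thm. 7.3)] -/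
theorem firstUnitCoeff_map_toCpInt_iff_mu_eq_zero_and_lam_eq {F : IwasawaAlgebra p} (hF : F ≠ 0)
    (n : ℕ) :
    (‖((coeff n (PowerSeries.map (R1.toCpInt p) F) : 𝓞_ℂ_[p]) : ℂ_[p])‖ = 1 ∧
        ∀ i < n, ‖((coeff i (PowerSeries.map (R1.toCpInt p) F) : 𝓞_ℂ_[p]) : ℂ_[p])‖ < 1) ↔
      MuLambda.mu F = 0 ∧ MuLambda.lam F = n := by
  rw [firstUnitCoeff_map_toCpInt_iff, firstUnitCoeff_iff_mu_eq_zero_and_lam_eq hF]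

/-! ### §3 Module currency: the shape of a generator of `Ch_Λ M` ⟺ `μ(M) = 0 ∧ λ(M) = n` -/

/-- **Weierstrass dictionary read in `𝓞_{ℂ_p}⟦T⟧` (module form, ⇒).** For a finitely generated torsion
`Λ`-module `M` with `μ(M) = 0` and `Ch_Λ M = (F)`, the first unit coefficient of `F♭ = map toCpInt F`
sits at `λ(M)`. [cite: Washington1997, §13.2 and §7.1 (Prop. 7.2, Thm. 7.3)] -/
theorem firstUnitCoeff_map_toCpInt_of_charIdeal_eq_span (M : Type*) [AddCommGroup M]
    [Module (IwasawaAlgebra p) M] [Module.Finite (IwasawaAlgebra p) M]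
    (hM : Module.IsTorsion (IwasawaAlgebra p) M) (hμ : muInvariant p M = 0) {F : IwasawaAlgebra p}
    (hF : Literature.NumberTheory.EllipticCurves.Module.charIdeal (IwasawaAlgebra p) M =
      Ideal.span {F}) :
    ‖((coeff (lambdaInvariant p M) (PowerSeries.map (R1.toCpInt p) F) : 𝓞_ℂ_[p]) : ℂ_[p])‖ = 1 ∧
      ∀ i < lambdaInvariant p M,
        ‖((coeff i (PowerSeries.map (R1.toCpInt p) F) : 𝓞_ℂ_[p]) : ℂ_[p])‖ < 1 :=
  (firstUnitCoeff_map_toCpInt_iff F _).mpr (firstUnitCoeff_of_charIdeal_eq_span M hM hμ hF)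

/-- **Weierstrass dictionary read in `𝓞_{ℂ_p}⟦T⟧` (module form, ⇐).** If `Ch_Λ M = (F)` for a finitely
generated torsion `M` and `F♭` has its first unit coefficient at `n`, then `μ(M) = 0` and `λ(M) = n`.
[cite: Washington1997, §13.2 and §7.1 (Prop. 7.2, Thm. 7.3)] -/
theorem invariants_of_firstUnitCoeff_map_toCpInt (M : Type*) [AddCommGroup M]
    [Module (IwasawaAlgebra p) M] [Module.Finite (IwasawaAlgebra p) M]
    (hM : Module.IsTorsion (IwasawaAlgebra p) M) {F : IwasawaAlgebra p}
    (hF : Literature.NumberTheory.EllipticCurves.Module.charIdeal (IwasawaAlgebra p) M =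
      Ideal.span {F}) {n : ℕ}
    (hn : ‖((coeff n (PowerSeries.map (R1.toCpInt p) F) : 𝓞_ℂ_[p]) : ℂ_[p])‖ = 1 ∧
      ∀ i < n, ‖((coeff i (PowerSeries.map (R1.toCpInt p) F) : 𝓞_ℂ_[p]) : ℂ_[p])‖ < 1) :
    muInvariant p M = 0 ∧ lambdaInvariant p M = n :=
  mu_eq_zero_and_lambda_eq_of_firstUnitCoeff_map_toUnr M hM hF
    ((firstUnitCoeff_map_toCpInt_iff_map_toUnr F n).mp hn)

/-- **The two currencies are equivalent** on a finitely generated torsion `Λ`-module with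
`Ch_Λ M = (F)`: `F♭` has its first unit coefficient at `n` iff `μ(M) = 0 ∧ λ(M) = n`.
[cite: Washington1997, §13.2 and §7.1 (Prop. 7.2, Thm. 7.3)] -/
theorem firstUnitCoeff_map_toCpInt_iff_invariants (M : Type*) [AddCommGroup M]
    [Module (IwasawaAlgebra p) M] [Module.Finite (IwasawaAlgebra p) M]
    (hM : Module.IsTorsion (IwasawaAlgebra p) M) {F : IwasawaAlgebra p}
    (hF : Literature.NumberTheory.EllipticCurves.Module.charIdeal (IwasawaAlgebra p) M =
      Ideal.span {F}) (n : ℕ) :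
    (‖((coeff n (PowerSeries.map (R1.toCpInt p) F) : 𝓞_ℂ_[p]) : ℂ_[p])‖ = 1 ∧
        ∀ i < n, ‖((coeff i (PowerSeries.map (R1.toCpInt p) F) : 𝓞_ℂ_[p]) : ℂ_[p])‖ < 1) ↔
      muInvariant p M = 0 ∧ lambdaInvariant p M = n := by
  refine ⟨invariants_of_firstUnitCoeff_map_toCpInt M hM hF, ?_⟩
  rintro ⟨hμ, rfl⟩
  exact firstUnitCoeff_map_toCpInt_of_charIdeal_eq_span M hM hμ hF

/-- **Generator currency ⟷ module currency.** For a finitely generated torsion `M` with `Ch_Λ M = (F)`: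
`μ(F) = μ(M)` and `λ(F) = λ(M)` (`X1.MuPart` / `X1.ParitySqueeze`), recorded as one conjunction for the
consumers of §4. [cite: Washington1997, §13.2] -/
theorem mu_lam_generator_eq_invariants (M : Type*) [AddCommGroup M]
    [Module (IwasawaAlgebra p) M] [Module.Finite (IwasawaAlgebra p) M]
    (hM : Module.IsTorsion (IwasawaAlgebra p) M) {F : IwasawaAlgebra p}
    (hF : Literature.NumberTheory.EllipticCurves.Module.charIdeal (IwasawaAlgebra p) M =
      Ideal.span {F}) :
    MuLambda.mu F = muInvariant p M ∧ MuLambda.lam F = lambdaInvariant p M :=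
  ⟨MuPart.mu_generator_eq_muInvariant M hM (generator_ne_zero hF) hF,
    ParitySqueeze.lam_generator_eq_lambdaInvariant M hM (generator_ne_zero hF) hF⟩

/-! ### §4 D′ at `𝔭̄` (crux 4, line b1, `stub_c3`) in the module-invariant currency, both signs -/

section DPrime

variable {W : WeierstrassCurve ℚ} [W.IsElliptic] [W.IsGloballyMinimal]

omit [W.IsGloballyMinimal] in
/-- **D′ at `𝔭̄`, non-split, FROM the invariants.** If at every binder of
`X2.NonsplitMuLambdaOnTreeIntOther W p` (non-split X2c Heegner datum, `d_K` odd, `(p) = 𝔭𝔭̄` split,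
anticyclotomic `κ, γ`, newform, embedding datum at `𝔭`, ♭-frame `Q` at `(ι′, 𝔭)`) the real module
`X := X_ac^∅(E_K[p^∞])` STRICT AT `𝔭̄` is `Λ`-torsion with `μ(X) = 0` and `Q` has its first unit
coefficient at `λ(X)` — Keller–Yin's μ-Lemma + `algmain` as PRINTED (invariants of `𝔛_f`), read for the
frame — then D′ holds in the tree's first-unit-coefficient currency (for EVERY generator `F` of `Ch_Λ X`,
by §3). Hypothesis stated INLINE (no new `Prop`); CONDITIONAL; nothing booked.
[cite: KellerYin2024, §5.1 (the μ-Lemma and `algmain`) (arXiv:2402.12781v2 L1740–L1756) (shape only; nothing asserted)]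
[cite: Washington1997, §13.2 and §7.1 Prop. 7.2] -/
theorem nonsplitMuLambdaOnTreeIntOther_of_invariants
    (h : ∀ (N : ℕ) [NeZero N] (K : Type) [Field K] [NumberField K] (Dt : ModularParametrizationData W N)
      (H : HeegnerDatum N (NumberField.discr K)) (ιK : K →+* ℂ) (P : (W.baseChange K).toAffine.Point),
      CellC W p → ¬ W.HasSplitMultiplicativeReductionAtPrime p → W.conductorNorm ℤ = N →
      IsImaginaryQuadratic K → NumberField.discr K < -4 → SatisfiesHeegnerHypothesis N K →
      (W.quadraticTwist (NumberField.discr K : ℚ)).entireLFunction 1 ≠ 0 →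
      WeierstrassCurve.Affine.Point.map ιK.toRatAlgHom P = heegnerPointComplex Dt H →
      ¬ (p : ℤ) ∣ Dt.c → ¬ IsOfFinAddOrder P →
      Odd (NumberField.discr K) →
      ∀ (κ : ZpExtension K p), κ.IsAnticyclotomic →
        ∀ (γ : Field.absoluteGaloisGroup K) [Fact (κ.IsTopGenerator γ)]
          (𝔭 : HeightOneSpectrum (𝓞 K)), ((p : ℕ) : 𝓞 K) ∈ 𝔭.asIdeal →
          𝔭.asIdeal.ramificationIdx (𝓞 ℚ) = 1 → 𝔭.asIdeal.inertiaDeg (𝓞 ℚ) = 1 →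
          ∀ (𝔭bar : HeightOneSpectrum (𝓞 K)), ((p : ℕ) : 𝓞 K) ∈ 𝔭bar.asIdeal → 𝔭bar ≠ 𝔭 →
            ((Ideal.span {(p : ℤ)}).primesOver (𝓞 K)).ncard = 2 →
          ∀ (f : CuspForm (CongruenceSubgroup.Gamma0 N) 2), IsNewformOf W f →
            ∀ (ι' : PadicAlgCl p ≃+* ℂ),
              (∀ (w : InfinitePlace K) (k : 𝓞 K),
                k ∈ 𝔭.asIdeal ↔ ‖ι'.symm (w.embedding (k : K))‖ < 1) →
              ∀ (ΩK : ℂ) (Ωp : ℂ_[p]) (Q : PowerSeries 𝓞_ℂ_[p]), ΩK ≠ 0 → ‖Ωp‖ = 1 →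
                R1.IsBDPLFunctionInt p ι' 𝔭 κ γ f ΩK Ωp Q →
                  Module.IsTorsion (IwasawaAlgebra p) (XAc (W.baseChange K) p κ 𝔭bar ∅ γ) ∧
                  muInvariant p (XAc (W.baseChange K) p κ 𝔭bar ∅ γ) = 0 ∧
                  (‖((PowerSeries.coeff (lambdaInvariant p (XAc (W.baseChange K) p κ 𝔭bar ∅ γ)) Q :
                      𝓞_ℂ_[p]) : ℂ_[p])‖ = 1 ∧
                    ∀ i < lambdaInvariant p (XAc (W.baseChange K) p κ 𝔭bar ∅ γ),
                      ‖((PowerSeries.coeff i Q : 𝓞_ℂ_[p]) : ℂ_[p])‖ < 1)) :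
    NonsplitMuLambdaOnTreeIntOther W p := by
  intro N _ K _ _ Dt H ιK P hc hns hN hK hd4 hHN hLt hP hcM hPinf hodd κ hκ γ _ 𝔭 h𝔭 he hf 𝔭bar h𝔭bar
    hne hsplit f hfW ι' hι' ΩK Ωp Q hΩK hΩp hQ F hF
  obtain ⟨htor, hμ, hQn⟩ := h N K Dt H ιK P hc hns hN hK hd4 hHN hLt hP hcM hPinf hodd κ hκ γ 𝔭 h𝔭 he
    hf 𝔭bar h𝔭bar hne hsplit f hfW ι' hι' ΩK Ωp Q hΩK hΩp hQ
  haveI := module_finite_XAc_baseChange (W := W) p κ 𝔭bar γ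
  exact ⟨lambdaInvariant p (XAc (W.baseChange K) p κ 𝔭bar ∅ γ),
    firstUnitCoeff_map_toCpInt_of_charIdeal_eq_span _ htor hμ hF, hQn⟩

omit [W.IsGloballyMinimal] in
/-- **D′ at `𝔭̄`, non-split, TO the invariants.** Conversely, `X2.NonsplitMuLambdaOnTreeIntOther W p`
gives, at every binder where `X := X_ac^∅(E_K[p^∞])` strict at `𝔭̄` is `Λ`-torsion (so that `μ(X)`,
`λ(X)` are the invariants of print): `μ(X) = 0` and the frame `Q` has its first unit coefficient at
`λ(X)` — i.e. «`μ(𝔛_f) = μ(𝓛_f) = 0` and `λ(𝔛_f) = λ(𝓛_f)`». (`Ch_Λ X` is principal: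
`charIdeal_isPrincipal_holds`; then §3.) CONDITIONAL on D′; nothing booked.
[cite: KellerYin2024, §5.1 (the μ-Lemma and `algmain`) (arXiv:2402.12781v2 L1740–L1756) (shape only; nothing asserted)]
[cite: Washington1997, §13.2 and §7.1 Prop. 7.2] -/
theorem invariants_of_nonsplitMuLambdaOnTreeIntOther (h : NonsplitMuLambdaOnTreeIntOther W p) :
    ∀ (N : ℕ) [NeZero N] (K : Type) [Field K] [NumberField K] (Dt : ModularParametrizationData W N)
      (H : HeegnerDatum N (NumberField.discr K)) (ιK : K →+* ℂ) (P : (W.baseChange K).toAffine.Point),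
      CellC W p → ¬ W.HasSplitMultiplicativeReductionAtPrime p → W.conductorNorm ℤ = N →
      IsImaginaryQuadratic K → NumberField.discr K < -4 → SatisfiesHeegnerHypothesis N K →
      (W.quadraticTwist (NumberField.discr K : ℚ)).entireLFunction 1 ≠ 0 →
      WeierstrassCurve.Affine.Point.map ιK.toRatAlgHom P = heegnerPointComplex Dt H →
      ¬ (p : ℤ) ∣ Dt.c → ¬ IsOfFinAddOrder P →
      Odd (NumberField.discr K) →
      ∀ (κ : ZpExtension K p), κ.IsAnticyclotomic →
        ∀ (γ : Field.absoluteGaloisGroup K) [Fact (κ.IsTopGenerator γ)]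
          (𝔭 : HeightOneSpectrum (𝓞 K)), ((p : ℕ) : 𝓞 K) ∈ 𝔭.asIdeal →
          𝔭.asIdeal.ramificationIdx (𝓞 ℚ) = 1 → 𝔭.asIdeal.inertiaDeg (𝓞 ℚ) = 1 →
          ∀ (𝔭bar : HeightOneSpectrum (𝓞 K)), ((p : ℕ) : 𝓞 K) ∈ 𝔭bar.asIdeal → 𝔭bar ≠ 𝔭 →
            ((Ideal.span {(p : ℤ)}).primesOver (𝓞 K)).ncard = 2 →
          ∀ (f : CuspForm (CongruenceSubgroup.Gamma0 N) 2), IsNewformOf W f →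
            ∀ (ι' : PadicAlgCl p ≃+* ℂ),
              (∀ (w : InfinitePlace K) (k : 𝓞 K),
                k ∈ 𝔭.asIdeal ↔ ‖ι'.symm (w.embedding (k : K))‖ < 1) →
              ∀ (ΩK : ℂ) (Ωp : ℂ_[p]) (Q : PowerSeries 𝓞_ℂ_[p]), ΩK ≠ 0 → ‖Ωp‖ = 1 →
                R1.IsBDPLFunctionInt p ι' 𝔭 κ γ f ΩK Ωp Q →
                  Module.IsTorsion (IwasawaAlgebra p) (XAc (W.baseChange K) p κ 𝔭bar ∅ γ) →
                  muInvariant p (XAc (W.baseChange K) p κ 𝔭bar ∅ γ) = 0 ∧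
                  (‖((PowerSeries.coeff (lambdaInvariant p (XAc (W.baseChange K) p κ 𝔭bar ∅ γ)) Q :
                      𝓞_ℂ_[p]) : ℂ_[p])‖ = 1 ∧
                    ∀ i < lambdaInvariant p (XAc (W.baseChange K) p κ 𝔭bar ∅ γ),
                      ‖((PowerSeries.coeff i Q : 𝓞_ℂ_[p]) : ℂ_[p])‖ < 1) := by
  intro N _ K _ _ Dt H ιK P hc hns hN hK hd4 hHN hLt hP hcM hPinf hodd κ hκ γ _ 𝔭 h𝔭 he hf 𝔭bar h𝔭bar
    hne hsplit f hfW ι' hι' ΩK Ωp Q hΩK hΩp hQ htor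
  obtain ⟨F, hF⟩ :=
    (charIdeal_isPrincipal_holds p (XAc (W.baseChange K) p κ 𝔭bar ∅ γ)).principal
  have hchar : XAc.charIdeal (W.baseChange K) p κ 𝔭bar ∅ γ = Ideal.span {F} := hF
  obtain ⟨n, hFn, hQn⟩ := h N K Dt H ιK P hc hns hN hK hd4 hHN hLt hP hcM hPinf hodd κ hκ γ 𝔭 h𝔭 he hf
    𝔭bar h𝔭bar hne hsplit f hfW ι' hι' ΩK Ωp Q hΩK hΩp hQ F hchar
  haveI := module_finite_XAc_baseChange (W := W) p κ 𝔭bar γ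
  obtain ⟨hμ, hlam⟩ := invariants_of_firstUnitCoeff_map_toCpInt _ htor hchar hFn
  exact ⟨hμ, hlam ▸ hQn⟩

omit [W.IsGloballyMinimal] in
/-- **D′ at `𝔭̄`, split, FROM the invariants** — `nonsplitMuLambdaOnTreeIntOther_of_invariants` with the
sign flipped (Keller–Yin §5 carries no sign hypothesis). CONDITIONAL; nothing booked.
[cite: KellerYin2024, §5.1 (the μ-Lemma and `algmain`) (arXiv:2402.12781v2 L1740–L1756) (shape only; nothing asserted)]
[cite: Washington1997, §13.2 and §7.1 Prop. 7.2] -/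
theorem splitMuLambdaOnTreeIntOther_of_invariants
    (h : ∀ (N : ℕ) [NeZero N] (K : Type) [Field K] [NumberField K] (Dt : ModularParametrizationData W N)
      (H : HeegnerDatum N (NumberField.discr K)) (ιK : K →+* ℂ) (P : (W.baseChange K).toAffine.Point),
      CellC W p → W.HasSplitMultiplicativeReductionAtPrime p → W.conductorNorm ℤ = N →
      IsImaginaryQuadratic K → NumberField.discr K < -4 → SatisfiesHeegnerHypothesis N K →
      (W.quadraticTwist (NumberField.discr K : ℚ)).entireLFunction 1 ≠ 0 →
      WeierstrassCurve.Affine.Point.map ιK.toRatAlgHom P = heegnerPointComplex Dt H →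
      ¬ (p : ℤ) ∣ Dt.c → ¬ IsOfFinAddOrder P →
      Odd (NumberField.discr K) →
      ∀ (κ : ZpExtension K p), κ.IsAnticyclotomic →
        ∀ (γ : Field.absoluteGaloisGroup K) [Fact (κ.IsTopGenerator γ)]
          (𝔭 : HeightOneSpectrum (𝓞 K)), ((p : ℕ) : 𝓞 K) ∈ 𝔭.asIdeal →
          𝔭.asIdeal.ramificationIdx (𝓞 ℚ) = 1 → 𝔭.asIdeal.inertiaDeg (𝓞 ℚ) = 1 →
          ∀ (𝔭bar : HeightOneSpectrum (𝓞 K)), ((p : ℕ) : 𝓞 K) ∈ 𝔭bar.asIdeal → 𝔭bar ≠ 𝔭 →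
            ((Ideal.span {(p : ℤ)}).primesOver (𝓞 K)).ncard = 2 →
          ∀ (f : CuspForm (CongruenceSubgroup.Gamma0 N) 2), IsNewformOf W f →
            ∀ (ι' : PadicAlgCl p ≃+* ℂ),
              (∀ (w : InfinitePlace K) (k : 𝓞 K),
                k ∈ 𝔭.asIdeal ↔ ‖ι'.symm (w.embedding (k : K))‖ < 1) →
              ∀ (ΩK : ℂ) (Ωp : ℂ_[p]) (Q : PowerSeries 𝓞_ℂ_[p]), ΩK ≠ 0 → ‖Ωp‖ = 1 →
                R1.IsBDPLFunctionInt p ι' 𝔭 κ γ f ΩK Ωp Q →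
                  Module.IsTorsion (IwasawaAlgebra p) (XAc (W.baseChange K) p κ 𝔭bar ∅ γ) ∧
                  muInvariant p (XAc (W.baseChange K) p κ 𝔭bar ∅ γ) = 0 ∧
                  (‖((PowerSeries.coeff (lambdaInvariant p (XAc (W.baseChange K) p κ 𝔭bar ∅ γ)) Q :
                      𝓞_ℂ_[p]) : ℂ_[p])‖ = 1 ∧
                    ∀ i < lambdaInvariant p (XAc (W.baseChange K) p κ 𝔭bar ∅ γ),
                      ‖((PowerSeries.coeff i Q : 𝓞_ℂ_[p]) : ℂ_[p])‖ < 1)) :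
    SplitMuLambdaOnTreeIntOther W p := by
  intro N _ K _ _ Dt H ιK P hc hs hN hK hd4 hHN hLt hP hcM hPinf hodd κ hκ γ _ 𝔭 h𝔭 he hf 𝔭bar h𝔭bar
    hne hsplit f hfW ι' hι' ΩK Ωp Q hΩK hΩp hQ F hF
  obtain ⟨htor, hμ, hQn⟩ := h N K Dt H ιK P hc hs hN hK hd4 hHN hLt hP hcM hPinf hodd κ hκ γ 𝔭 h𝔭 he
    hf 𝔭bar h𝔭bar hne hsplit f hfW ι' hι' ΩK Ωp Q hΩK hΩp hQ
  haveI := module_finite_XAc_baseChange (W := W) p κ 𝔭bar γ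
  exact ⟨lambdaInvariant p (XAc (W.baseChange K) p κ 𝔭bar ∅ γ),
    firstUnitCoeff_map_toCpInt_of_charIdeal_eq_span _ htor hμ hF, hQn⟩

omit [W.IsGloballyMinimal] in
/-- **D′ at `𝔭̄`, split, TO the invariants** — `invariants_of_nonsplitMuLambdaOnTreeIntOther` with the
sign flipped. CONDITIONAL on D′; nothing booked.
[cite: KellerYin2024, §5.1 (the μ-Lemma and `algmain`) (arXiv:2402.12781v2 L1740–L1756) (shape only; nothing asserted)]
[cite: Washington1997, §13.2 and §7.1 Prop. 7.2] -/
theorem invariants_of_splitMuLambdaOnTreeIntOther (h : SplitMuLambdaOnTreeIntOther W p) :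
    ∀ (N : ℕ) [NeZero N] (K : Type) [Field K] [NumberField K] (Dt : ModularParametrizationData W N)
      (H : HeegnerDatum N (NumberField.discr K)) (ιK : K →+* ℂ) (P : (W.baseChange K).toAffine.Point),
      CellC W p → W.HasSplitMultiplicativeReductionAtPrime p → W.conductorNorm ℤ = N →
      IsImaginaryQuadratic K → NumberField.discr K < -4 → SatisfiesHeegnerHypothesis N K →
      (W.quadraticTwist (NumberField.discr K : ℚ)).entireLFunction 1 ≠ 0 →
      WeierstrassCurve.Affine.Point.map ιK.toRatAlgHom P = heegnerPointComplex Dt H →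
      ¬ (p : ℤ) ∣ Dt.c → ¬ IsOfFinAddOrder P →
      Odd (NumberField.discr K) →
      ∀ (κ : ZpExtension K p), κ.IsAnticyclotomic →
        ∀ (γ : Field.absoluteGaloisGroup K) [Fact (κ.IsTopGenerator γ)]
          (𝔭 : HeightOneSpectrum (𝓞 K)), ((p : ℕ) : 𝓞 K) ∈ 𝔭.asIdeal →
          𝔭.asIdeal.ramificationIdx (𝓞 ℚ) = 1 → 𝔭.asIdeal.inertiaDeg (𝓞 ℚ) = 1 →
          ∀ (𝔭bar : HeightOneSpectrum (𝓞 K)), ((p : ℕ) : 𝓞 K) ∈ 𝔭bar.asIdeal → 𝔭bar ≠ 𝔭 →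
            ((Ideal.span {(p : ℤ)}).primesOver (𝓞 K)).ncard = 2 →
          ∀ (f : CuspForm (CongruenceSubgroup.Gamma0 N) 2), IsNewformOf W f →
            ∀ (ι' : PadicAlgCl p ≃+* ℂ),
              (∀ (w : InfinitePlace K) (k : 𝓞 K),
                k ∈ 𝔭.asIdeal ↔ ‖ι'.symm (w.embedding (k : K))‖ < 1) →
              ∀ (ΩK : ℂ) (Ωp : ℂ_[p]) (Q : PowerSeries 𝓞_ℂ_[p]), ΩK ≠ 0 → ‖Ωp‖ = 1 →
                R1.IsBDPLFunctionInt p ι' 𝔭 κ γ f ΩK Ωp Q →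
                  Module.IsTorsion (IwasawaAlgebra p) (XAc (W.baseChange K) p κ 𝔭bar ∅ γ) →
                  muInvariant p (XAc (W.baseChange K) p κ 𝔭bar ∅ γ) = 0 ∧
                  (‖((PowerSeries.coeff (lambdaInvariant p (XAc (W.baseChange K) p κ 𝔭bar ∅ γ)) Q :
                      𝓞_ℂ_[p]) : ℂ_[p])‖ = 1 ∧
                    ∀ i < lambdaInvariant p (XAc (W.baseChange K) p κ 𝔭bar ∅ γ),
                      ‖((PowerSeries.coeff i Q : 𝓞_ℂ_[p]) : ℂ_[p])‖ < 1) := by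
  intro N _ K _ _ Dt H ιK P hc hs hN hK hd4 hHN hLt hP hcM hPinf hodd κ hκ γ _ 𝔭 h𝔭 he hf 𝔭bar h𝔭bar
    hne hsplit f hfW ι' hι' ΩK Ωp Q hΩK hΩp hQ htor
  obtain ⟨F, hF⟩ :=
    (charIdeal_isPrincipal_holds p (XAc (W.baseChange K) p κ 𝔭bar ∅ γ)).principal
  have hchar : XAc.charIdeal (W.baseChange K) p κ 𝔭bar ∅ γ = Ideal.span {F} := hF
  obtain ⟨n, hFn, hQn⟩ := h N K Dt H ιK P hc hs hN hK hd4 hHN hLt hP hcM hPinf hodd κ hκ γ 𝔭 h𝔭 he hf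
    𝔭bar h𝔭bar hne hsplit f hfW ι' hι' ΩK Ωp Q hΩK hΩp hQ F hchar
  haveI := module_finite_XAc_baseChange (W := W) p κ 𝔭bar γ
  obtain ⟨hμ, hlam⟩ := invariants_of_firstUnitCoeff_map_toCpInt _ htor hchar hFn
  exact ⟨hμ, hlam ▸ hQn⟩

end DPrime

end Summit.BirchSwinnertonDyer.BirchSwinnertonDyer.Theorems.StubC3MuLambdaInvariants

end
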